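import Summits.KontsevichZagierPeriods.KontsevichZagierPeriods.Theorems.GpcZeta4Eq4zeta31.Negative.LoadBearing
import Summits.KontsevichZagierPeriods.KontsevichZagierPeriods.Theorems.HoffmanRelationInKZ.Negative.NoStokesLocality
import Summits.KontsevichZagierPeriods.KontsevichZagierPeriods.Theorems.StuffleInKZ.Negative.NewtonLeibnizFree
import Summits.KontsevichZagierPeriods.KontsevichZagierPeriods.Theorems.StuffleInKZ.Negative.LoadBearing

/-!
# `GpcZeta4Eq4zeta31` (stmt-KontsevichZagierPeriods-0275): negative side — sub-calculi, refuted
# strengthenings, and tightness of the known invariants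

Companion of `Negative/Core.lean` and `Negative/LoadBearing.lean` (cdisprove unit of the crux
`GpcZeta4Eq4zeta31`, route `Grothendieck`). For the typed target `cFds4 = [Δ₄, ω₀₀₀₁] − [Δ₄, 4ω₀₀₁₁]`:

* `target_not_mem_addOnly`, `not_cruxInAddOnly` — the additivity-only sub-calculus
  `closure (domainAdd ∪ integrandAdd)` does NOT contain the target (window evaluation on the box `B` is
  positive): every move chain for `ζ(4) = 4ζ(3,1)` uses a change of variables or a Newton–Leibniz move;
* `target_not_single_move` — the target is not ONE additivity generator (augmentation `−1` versus `0`)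
  nor ONE Newton–Leibniz generator (a `dimCount` equal to `−1` versus all `0`), in either direction;
  whether it is one change of variables (a semialgebraic transport of measures on `Δ₄`) is open;
  `target_ne_zero` — it is not `0` in the free group;
* (companion `PermScissors.lean`: the shuffle toolkit — dissections, integrand additivity, coordinate
  permutations — does not prove the crux either);
* `crux_iff_dual` — by the duality move the crux is "`ζ(2,1,1) = 4ζ(3,1)` inside the calculus";
* TIGHTNESS (no obstruction): `gradedEval_target` (the invariant of the Newton–Leibniz-free sub-calculus
  vanishes in every degree), `aug_target` (augmentation `0`: no obstruction to an additivity-balanced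
  chain), `dimProj_target` / `target_noStokes_locality` (pure dimension 4: an NL-free chain is a chain of
  scissors and substitutions among 4-dimensional representations only).

Sources: M. Kontsevich, D. Zagier, *Periods* (2001), §1.2.
-/

noncomputable section

namespace Summit.KontsevichZagierPeriods.GpcZeta4Eq4zeta31.Negative

open Set MeasureTheory
open Literature.NumberTheory.Transcendental
open Literature.NumberTheory.Transcendental.KZ
open Summit.KontsevichZagierPeriods.KontsevichZagierPeriods.Theses.Grothendieck (GpcZeta4Eq4zeta31)
open Summit.KontsevichZagierPeriods.MzvKernelInKZ.Negative
open Summit.KontsevichZagierPeriods.HoffmanRelationInKZ.Negative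
  (window windowEval windowEval_of addOnly addOnly_le_ker_windowEval measurableSet_window lo₄ hi₄
    window₄_subset noStokes noStokesDim dimProj dimProj_of mem_noStokesDim_of_pure)
open Summit.KontsevichZagierPeriods.Theorems.StuffleInKZ.Negative (gradedEval gradedEval_of aug aug_of)

/-! ## §4 Refuted strengthenings and sub-calculi; tightness where there is no obstruction -/

/-- **Window evaluation of the target is positive** on the box `B ⊆ Δ₄`:
`∫_B (ω₀₀₀₁ − 4ω₀₀₁₁) > 0`. [folklore] -/
theorem windowEval_target_pos : 0 < windowEval (window lo₄ hi₄) cFds4 := by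
  rw [cFds4_eq, map_sub, windowEval_of, windowEval_of, wordRep_domain, wordRep_domain, wordRep_integrand,
    wordRep_integrand]
  change 0 < (∫ x in openOrderedSimplex 4 ∩ window lo₄ hi₄ 4, wordFun ω4 1 x) -
    ∫ x in openOrderedSimplex 4 ∩ window lo₄ hi₄ 4, wordFun ω31 4 x
  rw [inter_eq_right.mpr window₄_subset]
  exact integral_gap_pos

/-- **The target is NOT in the additivity-only sub-calculus** `addOnly = closure (domainAdd ∪ integrandAdd)`
(window evaluation kills `addOnly` and is positive on the target). [folklore] -/
theorem target_not_mem_addOnly : cFds4 ∉ addOnly := fun h => by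
  have h0 := addOnly_le_ker_windowEval (A := window lo₄ hi₄) (fun n => measurableSet_window _ _ n) h
  rw [AddMonoidHom.mem_ker] at h0
  exact windowEval_target_pos.ne' h0

/-- The crux with `KZ.relations` replaced by the additivity-only sub-calculus. -/
def CruxInAddOnly : Prop :=
  ∀ (r r' : IntegralRep 4), r.domain = {t | 1 > t 0 ∧ t 0 > t 1 ∧ t 1 > t 2 ∧ t 2 > t 3 ∧ t 3 > 0} →
    EqOn r.integrand (fun t => 1 / (t 0 * t 1 * t 2 * (1 - t 3))) r.domain → r'.domain = r.domain →
    EqOn r'.integrand (fun t => 4 / (t 0 * t 1 * (1 - t 2) * (1 - t 3))) r'.domain →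
    of r - of r' ∈ addOnly

/-- **Refuted strengthening: additivity alone does not prove `ζ(4) = 4ζ(3,1)`** — every move chain for
the crux contains at least one change of variables or one Newton–Leibniz move. [folklore] -/
theorem not_cruxInAddOnly : ¬ CruxInAddOnly := fun h =>
  target_not_mem_addOnly (h (wordRep ω4 1 adm_ω4) (wordRep ω31 4 adm_ω31)
    (by rw [wordRep_domain, simplex4_eq]) (fun t _ => wordFun_ω4_one t) rfl (fun t _ => wordFun_ω31_four t))

/-- **TIGHTNESS (graded evaluation)**: the target is homogeneous of dimension 4 and evaluates to `0`
there, so graded evaluation — the invariant of the Newton–Leibniz-free sub-calculus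
`nlFreeRelations = closure (domainAdd ∪ integrandAdd ∪ CoV)` — does NOT obstruct an NL-free chain.
(Expected: line (β) of the route — shuffle dissection, duality, Eie's rational change of variables,
cubical stuffle — is rules (1)+(2) in dimension 4 throughout.) [folklore] -/
theorem gradedEval_target (N : ℕ) : gradedEval N cFds4 = 0 := by
  rw [cFds4_eq, map_sub, gradedEval_of, gradedEval_of, value_ω4, value_right]
  split_ifs <;> simp

/-- **TIGHTNESS (augmentation)**: `aug (target) = 0`, so the augmentation — which kills
`covNLRelations = closure (CoV ∪ NL)` and counts `−1` per additivity generator — does NOT obstruct an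
additivity-free chain either: in any expression of the target by move generators the additivity
generators occur with signed multiplicity summing to `0`. (Contrast: the stuffle defect has
`aug = 1 − #(s∗t) ≤ −2`, `StuffleInKZ/Negative/LoadBearing.lean`.) [folklore] -/
theorem aug_target : aug cFds4 = 0 := by
  rw [cFds4_eq, map_sub, aug_of, aug_of, sub_self]

/-- The target is pure of dimension 4. [folklore] -/
theorem dimProj_target : dimProj 4 cFds4 = cFds4 := by
  rw [cFds4_eq, map_sub, dimProj_of, dimProj_of, if_pos rfl, if_pos rfl]

/-- **No-Stokes locality for the crux**: a Newton–Leibniz-free move chain for `ζ(4) = 4ζ(3,1)` is a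
chain of scissors and substitutions among 4-dimensional representations ONLY (no auxiliary variable,
no product with an interval, no homotopy parameter). [folklore] -/
theorem target_noStokes_locality (h : cFds4 ∈ noStokes) : cFds4 ∈ noStokesDim 4 :=
  mem_noStokesDim_of_pure h dimProj_target

/-- Count of generators of dimension `k` (with sign). [folklore] -/
def dimCount (k : ℕ) : FormalRep →+ ℤ := FreeAbelianGroup.lift fun r => if r.1 = k then 1 else 0

/-- `dimCount k [r]`. [folklore] -/
@[simp] theorem dimCount_of (k : ℕ) {n : ℕ} (r : IntegralRep n) :
    dimCount k (of r) = if n = k then 1 else 0 :=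
  FreeAbelianGroup.lift_apply_of _ _

/-- Every `dimCount` of the target vanishes (two generators of dimension 4 with opposite signs). [folklore] -/
theorem dimCount_target (k : ℕ) : dimCount k cFds4 = 0 := by
  rw [cFds4_eq, map_sub, dimCount_of, dimCount_of, sub_self]

/-- A Newton–Leibniz generator `[band] − [base]` has `dimCount (dim base) = −1`. [folklore] -/
theorem exists_dimCount_eq_neg_one_of_mem_newtonLeibnizRel {c : FormalRep} (hc : c ∈ newtonLeibnizRel) :
    ∃ n, dimCount n c = -1 := by
  obtain ⟨n, r, r', -, -, -, -, -, -, -, -, -, -, -, rfl⟩ := hc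
  refine ⟨n, ?_⟩
  rw [map_sub, dimCount_of, dimCount_of, if_neg (Nat.succ_ne_self n), if_pos rfl]
  norm_num

/-- An additivity generator `[r] − [r₁] − [r₂]` has augmentation `−1`. [folklore] -/
theorem aug_eq_neg_one_of_mem_addRel {c : FormalRep} (hc : c ∈ domainAddRel ∪ integrandAddRel) :
    aug c = -1 := by
  rcases hc with hc | hc
  · obtain ⟨n, r, r₁, r₂, -, -, -, -, rfl⟩ := hc
    simp
  · obtain ⟨n, r, r₁, r₂, -, -, -, rfl⟩ := hc
    simp

/-- **The target is not ONE additivity move nor ONE Newton–Leibniz move (in either direction)**: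
additivity generators have augmentation `−1` (the target has `0`), Newton–Leibniz generators have a
`dimCount` equal to `−1` (the target has all `dimCount`s `0`). Whether `±target` is ONE change of
variables — a `ℚ`-semialgebraic injective a.e.-differentiable `Φ : Δ₄ → Δ₄` with
`ω₀₀₀₁ = (4ω₀₀₁₁ ∘ Φ)·|det Φ'|`, i.e. a semialgebraic transport between the two measures — is OPEN
(see §5). [folklore] -/
theorem target_not_single_move :
    cFds4 ∉ domainAddRel ∪ integrandAddRel ∪ newtonLeibnizRel ∧
      -cFds4 ∉ domainAddRel ∪ integrandAddRel ∪ newtonLeibnizRel := by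
  constructor
  · rintro (hc | hc)
    · have h := aug_eq_neg_one_of_mem_addRel hc
      rw [aug_target] at h
      norm_num at h
    · obtain ⟨n, hn⟩ := exists_dimCount_eq_neg_one_of_mem_newtonLeibnizRel hc
      rw [dimCount_target] at hn
      norm_num at hn
  · rintro (hc | hc)
    · have h := aug_eq_neg_one_of_mem_addRel hc
      rw [map_neg, aug_target] at h
      norm_num at h
    · obtain ⟨n, hn⟩ := exists_dimCount_eq_neg_one_of_mem_newtonLeibnizRel hc
      rw [map_neg, dimCount_target] at hn
      norm_num at hn

/-- **Refuted strengthening (exactness in the free group)**: the target is not `0` in `FormalRep` — the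
two representations are genuinely different generators (their integrands differ at the rational point
`(11/20, 9/40, 7/40, 3/40)` of the box), so at least one move is needed. [folklore] -/
theorem target_ne_zero : cFds4 ≠ 0 := fun h => by
  have h0 := windowEval_target_pos
  rw [h, map_zero] at h0
  exact lt_irrefl _ h0

/-! ## An equivalent form by one move -/

/-- **Dual form** (duality `ζ(4) = ζ(2,1,1)` is one change-of-variables move, `cDual4_mem_relations`):
the crux is equivalent to `[Δ₄, ω₀₁₁₁] − [Δ₄, 4ω₀₀₁₁] ∈ relations`, i.e. to "`ζ(2,1,1) = 4ζ(3,1)` inside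
the calculus" (the word `0011` is self-dual). [folklore] -/
theorem crux_iff_dual :
    GpcZeta4Eq4zeta31 ↔ of (wordRep ω211 1 adm_ω211) - of (wordRep ω31 4 adm_ω31) ∈ relations := by
  rw [crux_iff_target]
  have hD : of (wordRep ω4 1 adm_ω4) - of (wordRep ω211 1 adm_ω211) ∈ relations := cDual4_mem_relations
  constructor
  · intro h
    have e : of (wordRep ω211 1 adm_ω211) - of (wordRep ω31 4 adm_ω31) =
        cFds4 - (of (wordRep ω4 1 adm_ω4) - of (wordRep ω211 1 adm_ω211)) := by
      rw [cFds4_eq]; abel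
    rw [e]
    exact relations.sub_mem h hD
  · intro h
    have e : cFds4 = (of (wordRep ω211 1 adm_ω211) - of (wordRep ω31 4 adm_ω31)) +
        (of (wordRep ω4 1 adm_ω4) - of (wordRep ω211 1 adm_ω211)) := by
      rw [cFds4_eq]; abel
    rw [e]
    exact relations.add_mem h hD


end Summit.KontsevichZagierPeriods.GpcZeta4Eq4zeta31.Negative
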